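import Literature.Topology.FourManifolds.SPC4Spin
import Literature.Topology.FourManifolds.ComplexProjectiveLineClutching
import Literature.AlgebraicTopology.FundamentalGroup.RotationLoopEssential
import HarnessLib

/-!
# `ℂℙ²` is not spin (discharge of `not_isSpin_complexProjectivePlane`)

Proof file attached to `Literature/Topology/FourManifolds/SPC4Spin.lean`. It discharges, sorry-free,
the named fact

* `Literature.Topology.FourManifolds.not_isSpin_complexProjectivePlane_holds :
    not_isSpin_complexProjectivePlane` — `¬ IsSpin (𝓡 4) ComplexProjectivePlane`,

for the tree's notion of a spin manifold (`Literature.Topology.FourManifolds.IsSpin`, Kirby's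
surface criterion adopted as the definition: orientable, and `f*TM ⊕ ℝ` trivial along every
continuous map `f` of a closed surface charted on `ℝ²`).

## Source and proof

Gompf–Stipsicz, *4-Manifolds and Kirby Calculus* (1999), Example 1.4.21 and Cor. 5.7.6; Kirby,
*The Topology of 4-Manifolds* (1989), Ch. II §1 ("`H₂(CP²; Z) = Z` with generator `CP¹ = S²` …
the normal bundle of `CP¹` is the Hopf bundle … the form is just `(1)`"), §4 Lemma 4.1 ("if
`H₁(M; Z) = 0` then `ω₂ = 0` iff the intersection form is even") and Ch. IV ("if `M⁴` is a complex
surface, then `ω₂` is the mod 2 reduction of the first Chern class `c₁`"); Milnor–Stasheff,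
*Characteristic Classes*, §14 (Thm 14.10: `w(ℂℙⁿ) = (1 + a)ⁿ⁺¹`). All say: `w₂(ℂℙ²) ≠ 0`, and it is
detected on the line `ℂℙ¹ ⊂ ℂℙ²`, i.e. `Tℂℙ²|_{ℂℙ¹} ⊕ ℝ ≅ (𝒪(2) ⊕ 𝒪(1))_ℝ ⊕ ℝ` is a non-trivial real
`5`-plane bundle over `S²` (odd total Chern number `3`).

The formal proof is the clutching computation behind these statements, carried out in the tree's
model of `ℂℙ²` (`ComplexProjectiveSpace.lean`: three affine charts valued in
`EuclideanSpace ℝ (Fin (2 * 2))` through `realCoordinates`):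

1. *The surface and the map.* `S = ℂℙ¹` (`ComplexProjectiveSpace 1`, charted on `ℝ²` by
   `ComplexProjectiveSpace.instChartedSpaceOne`) and `f = lineIncl : [v₀ : v₁] ↦ [v₀ : v₁ : 0]`
   (`ComplexProjectiveLineClutching.lean`). The hypothesis `IsSpin` is first transported, by
   definitional unfolding of the re-exported instances, from `ComplexProjectivePlane` at the literal
   model `𝓡 4` to `ComplexProjectiveSpace 2` at `𝓡 (2 * 2)`.
2. *Reading the framing in the charts* (`ComplexProjectiveSpace.exists_clutching_extension`). A
   stable framing `σ` of `f*Tℂℙ² ⊕ ℝ` read in the trivialisation of `Tℂℙ²` over the affine chart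
   `0` along `w ↦ [1 : w]`, resp. over the chart `1` along `u ↦ [u : 1]`, is a continuous family of
   invertible `5 × 5` frame matrices `F₀(w)`, resp. `F₁(u)`, `w, u ∈ ℂ` (continuity of the local
   trivialisations of Mathlib's `tangentBundleCore`, linear independence transported through the
   fibrewise-injective coordinate changes).
3. *The clutching function* (`ComplexProjectiveSpace.coordChange_zero_one_apply`). On the unit
   circle `[1 : w] = [w̄ : 1]`, and the cocycle property of `tangentBundleCore` gives
   `F₁(w̄) = J(w) F₀(w)` with `J(w)` the coordinate change `0 → 1` of `Tℂℙ²` at `[1 : w : 0]`: the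
   derivative of the chart change `(a, b) ↦ (1/a, b/a)` at `(w, 0)`, i.e. the realification
   `cmat (-1/w²) (1/w)` of the complex diagonal matrix `diag(-1/w², 1/w)` (computed with
   `HasFDerivAt` through `realCoordinates`).
4. *The disc extension.* `G(w) = F₁(w̄) F₀(w)⁻¹ pmat(w)` is continuous and invertible on all of
   `ℂ`, where `pmat(w)` (right multiplication by the quaternion `w + (1 - |w|²) j`, realified and
   stabilised) is an explicit null-homotopy of the even loop `cmat (-w) w`; on the unit circle
   `G(w) = cmat (-1/w²) (1/w) · cmat (-w) w = cmat w̄ 1`, one full turn of a coordinate rotation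
   stabilised to `GL₅(ℝ)` (`RotLoop.rotBlock 2`).
5. *The contradiction* (`RotLoop.disc_false 2`, `RotationLoopEssential.lean`): that loop does not
   extend over the disc in `GL₅(ℝ)` — two peeling steps through `π₂(S⁴) = π₂(S³) = 0` reduce to
   `GL₃(ℝ)`, where the Gram–Schmidt retraction to `SO(3)` and the covering `S³ → SO(3)` detect it
   (`π₁(SO(3)) = ℤ/2`).

Theorems only; no definitions, no named facts.

## References

* R. Gompf, A. Stipsicz, *4-Manifolds and Kirby Calculus*, GSM 20, AMS (1999), Example 1.4.21,
  Cor. 5.7.6. [GompfStipsiczGSM1999]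
* R. Kirby, *The Topology of 4-Manifolds*, LNM 1374, Springer (1989), Ch. II §1, §4 (Lemma 4.1),
  Ch. IV. [Kirby1989]
* J. Milnor, J. Stasheff, *Characteristic Classes*, Princeton (1974), §14 Thm 14.10.
  [MilnorStasheffAMS76]
* A. Hatcher, *Algebraic Topology*, CUP (2002), §3.D (`π₁(SO(n)) = ℤ₂`). [HatcherAT2002]
-/

open scoped Manifold ContDiff Topology ComplexConjugate
open Set Function Matrix

noncomputable section

namespace Literature.Topology.FourManifolds

namespace ComplexProjectiveSpace

open Bundle

/-! ### The chart change `0 → 1` of `ℂℙ²` along the line and its derivative -/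

/-- Homogenisation in the chart `0` of `ℂℙ²`: `(a, b) ↦ (1, a, b)`. [folklore] -/
theorem coe_homogenize_zero_fin_two (u : Fin 2 → ℂ) :
    (homogenize 0 u : Fin 3 → ℂ) = ![1, u 0, u 1] := by
  ext m
  fin_cases m <;> rfl

/-- The complex transition function between the affine charts `0` and `1` of `ℂℙ²` is
`(a, b) ↦ (1/a, b/a)`. [folklore] -/
theorem transitionComplex_zero_one (u : Fin 2 → ℂ) :
    transitionComplex (n := 2) 0 1 u = ![(u 0)⁻¹, u 1 * (u 0)⁻¹] := by
  ext j
  simp only [transitionComplex, coe_homogenize_zero_fin_two]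
  fin_cases j
  · simp
  · simp [div_eq_mul_inv]

/-- **The complex Jacobian of the chart change along the line**: at `(w, 0)`, `w ≠ 0`, the
derivative of `(a, b) ↦ (1/a, b/a)` is the diagonal map `(da, db) ↦ (-da/w², db/w)`
(Milnor–Stasheff §14; Griffiths–Harris Ch. 0 §2). [folklore] -/
theorem hasFDerivAt_transitionComplex_zero_one {w : ℂ} (hw : w ≠ 0) :
    HasFDerivAt (transitionComplex (n := 2) 0 1)
      (ContinuousLinearMap.pi ![(-(w ^ 2)⁻¹) • (ContinuousLinearMap.proj 0 : (Fin 2 → ℂ) →L[ℂ] ℂ),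
        w⁻¹ • (ContinuousLinearMap.proj 1 : (Fin 2 → ℂ) →L[ℂ] ℂ)]) ![w, 0] := by
  have hfun : transitionComplex (n := 2) 0 1 = fun u ↦ ![(u 0)⁻¹, u 1 * (u 0)⁻¹] :=
    funext transitionComplex_zero_one
  rw [hfun, hasFDerivAt_pi']
  have hp0 : HasFDerivAt (fun u : Fin 2 → ℂ ↦ u 0)
      (ContinuousLinearMap.proj 0 : (Fin 2 → ℂ) →L[ℂ] ℂ) ![w, 0] :=
    (ContinuousLinearMap.proj (R := ℂ) (φ := fun _ : Fin 2 ↦ ℂ) 0).hasFDerivAt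
  have hp1 : HasFDerivAt (fun u : Fin 2 → ℂ ↦ u 1)
      (ContinuousLinearMap.proj 1 : (Fin 2 → ℂ) →L[ℂ] ℂ) ![w, 0] :=
    (ContinuousLinearMap.proj (R := ℂ) (φ := fun _ : Fin 2 ↦ ℂ) 1).hasFDerivAt
  have hinv : HasFDerivAt (fun u : Fin 2 → ℂ ↦ (u 0)⁻¹)
      ((ContinuousLinearMap.toSpanSingleton ℂ (-(w ^ 2)⁻¹)).comp
        (ContinuousLinearMap.proj 0 : (Fin 2 → ℂ) →L[ℂ] ℂ)) ![w, 0] :=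
    (hasFDerivAt_inv (𝕜 := ℂ) hw).comp (![w, 0] : Fin 2 → ℂ) hp0
  have h0 : HasFDerivAt (fun u : Fin 2 → ℂ ↦ (u 0)⁻¹)
      ((-(w ^ 2)⁻¹) • (ContinuousLinearMap.proj 0 : (Fin 2 → ℂ) →L[ℂ] ℂ)) ![w, 0] := by
    refine hinv.congr_fderiv ?_
    ext u
    simp [mul_comm]
  have h1 : HasFDerivAt (fun u : Fin 2 → ℂ ↦ u 1 * (u 0)⁻¹)
      (w⁻¹ • (ContinuousLinearMap.proj 1 : (Fin 2 → ℂ) →L[ℂ] ℂ)) ![w, 0] := by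
    refine (hp1.mul hinv).congr_fderiv ?_
    ext u
    simp [mul_comm]
  intro i
  fin_cases i
  · simpa using h0
  · simpa using h1

/-- The derivative of the change of affine charts `(affineChart 1) ∘ (affineChart 0)⁻¹` of `ℂℙ²` at
the point `realCoordinates 2 (w, 0)` of the line, `w ≠ 0`: the realification of
`diag(-1/w², 1/w)`. [folklore] -/
theorem hasFDerivAt_affineChart_one_comp_symm_zero {w : ℂ} (hw : w ≠ 0) :
    HasFDerivAt
      ((affineChart 1 : ComplexProjectiveSpace 2 → EuclideanSpace ℝ (Fin (2 * 2))) ∘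
        (affineChart 0).symm)
      ((realCoordinates 2 : (Fin 2 → ℂ) →L[ℝ] EuclideanSpace ℝ (Fin (2 * 2))).comp
        (((ContinuousLinearMap.pi
            ![(-(w ^ 2)⁻¹) • (ContinuousLinearMap.proj 0 : (Fin 2 → ℂ) →L[ℂ] ℂ),
              w⁻¹ • (ContinuousLinearMap.proj 1 : (Fin 2 → ℂ) →L[ℂ] ℂ)]).restrictScalars ℝ).comp
          ((realCoordinates 2).symm : EuclideanSpace ℝ (Fin (2 * 2)) →L[ℝ] (Fin 2 → ℂ))))
      (realCoordinates 2 ![w, 0]) := by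
  have hcomp : (affineChart 1 : ComplexProjectiveSpace 2 → EuclideanSpace ℝ (Fin (2 * 2))) ∘
      (affineChart 0).symm = realCoordinates 2 ∘ transitionComplex 0 1 ∘ (realCoordinates 2).symm :=
    rfl
  rw [hcomp]
  refine (realCoordinates 2).hasFDerivAt.comp _
    (HasFDerivAt.comp _ ?_ (realCoordinates 2).symm.hasFDerivAt)
  rw [ContinuousLinearEquiv.symm_apply_apply]
  exact (hasFDerivAt_transitionComplex_zero_one hw).restrictScalars ℝ

/-- **The coordinate change of `Tℂℙ²` from the affine chart `0` to the affine chart `1` at the point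
`[1 : w : 0]` of the line**, `w ≠ 0`, applied to a tangent vector `v` (read in `ℝ⁴` through
`realCoordinates 2`): multiply the complex coordinates by `-1/w²` and `1/w`. [folklore] -/
theorem coordChange_zero_one_apply {w : ℂ} (hw : w ≠ 0) (v : EuclideanSpace ℝ (Fin (2 * 2))) :
    (tangentBundleCore (𝓡 (2 * 2)) (ComplexProjectiveSpace 2)).coordChange (chartMem 0) (chartMem 1)
        (lineIncl (linePt₀ w)) v =
      realCoordinates 2 ![(-(w ^ 2)⁻¹) * (realCoordinates 2).symm v 0,
        w⁻¹ * (realCoordinates 2).symm v 1] := by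
  rw [tangentBundleCore_coordChange]
  simp only [coe_chartMem, OpenPartialHomeomorph.extend_coe, OpenPartialHomeomorph.extend_coe_symm,
    modelWithCornersSelf_coe, modelWithCornersSelf_coe_symm, Set.range_id, fderivWithin_univ,
    CompTriple.comp_eq]
  rw [affineChart_zero_lineIncl_linePt₀, (hasFDerivAt_affineChart_one_comp_symm_zero hw).fderiv]
  simp only [ContinuousLinearMap.coe_comp, ContinuousLinearEquiv.coe_coe, Function.comp_apply,
    ContinuousLinearMap.coe_restrictScalars']
  congr 1
  funext i
  fin_cases i <;> simp

/-! ### Reading a framing along a map in the affine charts -/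

variable {S : Type*} [TopologicalSpace S]

/-- **Continuity of a section read in an affine chart.** If `p ↦ (f p, v p)` is continuous into
the tangent bundle of `ℂℙ²`, then on `f⁻¹(U_k)` its reading in the trivialisation over the affine
chart `k` is a continuous map to `ℝ⁴`. [folklore] -/
theorem continuousOn_localTriv_chartMem {f : S → ComplexProjectiveSpace 2}
    {v : S → EuclideanSpace ℝ (Fin (2 * 2))}
    (hv : Continuous fun p ↦ (TotalSpace.mk' (EuclideanSpace ℝ (Fin (2 * 2))) (f p) (v p) :
      TangentBundle (𝓡 (2 * 2)) (ComplexProjectiveSpace 2))) (k : Fin 3) :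
    ContinuousOn (fun p ↦ ((tangentBundleCore (𝓡 (2 * 2)) (ComplexProjectiveSpace 2)).localTriv
      (chartMem k) (TotalSpace.mk' (EuclideanSpace ℝ (Fin (2 * 2))) (f p) (v p))).2)
      {p | CoordNeZero k (f p)} := by
  refine continuous_snd.comp_continuousOn
    ((Trivialization.continuousOn _).comp hv.continuousOn fun p hp ↦ ?_)
  rw [VectorBundleCore.mem_localTriv_source]
  exact hp

/-- The reading in the chart `k` is the coordinate change from the preferred chart. [folklore] -/
theorem localTriv_chartMem_snd (k : Fin 3) (x : ComplexProjectiveSpace 2)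
    (v : EuclideanSpace ℝ (Fin (2 * 2))) :
    ((tangentBundleCore (𝓡 (2 * 2)) (ComplexProjectiveSpace 2)).localTriv (chartMem k)
        (TotalSpace.mk' (EuclideanSpace ℝ (Fin (2 * 2))) x v)).2 =
      (tangentBundleCore (𝓡 (2 * 2)) (ComplexProjectiveSpace 2)).coordChange
        (achart (EuclideanSpace ℝ (Fin (2 * 2))) x) (chartMem k) x v := rfl

/-- **The coordinate change from the preferred chart to an affine chart containing the point is
injective** (its inverse is the coordinate change back). [folklore] -/
theorem coordChange_achart_chartMem_injective {k : Fin 3} {x : ComplexProjectiveSpace 2}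
    (hx : CoordNeZero k x) :
    Function.Injective ((tangentBundleCore (𝓡 (2 * 2)) (ComplexProjectiveSpace 2)).coordChange
      (achart (EuclideanSpace ℝ (Fin (2 * 2))) x) (chartMem k) x) := by
  set Z := tangentBundleCore (𝓡 (2 * 2)) (ComplexProjectiveSpace 2)
  have hxa : x ∈ Z.baseSet (achart (EuclideanSpace ℝ (Fin (2 * 2))) x) := Z.mem_baseSet_at x
  have hxk : x ∈ Z.baseSet (chartMem k) := hx
  intro v v' h
  have h1 := Z.coordChange_comp (achart _ x) (chartMem k) (achart _ x) x ⟨⟨hxa, hxk⟩, hxa⟩ v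
  have h2 := Z.coordChange_comp (achart _ x) (chartMem k) (achart _ x) x ⟨⟨hxa, hxk⟩, hxa⟩ v'
  rw [Z.coordChange_self _ x hxa] at h1 h2
  rw [← h1, ← h2, h]

/-- **Cocycle**: reading in the chart `1` is the coordinate change `0 → 1` applied to the reading in
the chart `0`, at points of `U₀ ∩ U₁`. [folklore] -/
theorem coordChange_achart_one_eq {x : ComplexProjectiveSpace 2} (h0 : CoordNeZero 0 x)
    (h1 : CoordNeZero 1 x) (v : EuclideanSpace ℝ (Fin (2 * 2))) :
    (tangentBundleCore (𝓡 (2 * 2)) (ComplexProjectiveSpace 2)).coordChange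
        (achart (EuclideanSpace ℝ (Fin (2 * 2))) x) (chartMem 1) x v =
      (tangentBundleCore (𝓡 (2 * 2)) (ComplexProjectiveSpace 2)).coordChange (chartMem 0)
        (chartMem 1) x
        ((tangentBundleCore (𝓡 (2 * 2)) (ComplexProjectiveSpace 2)).coordChange
          (achart (EuclideanSpace ℝ (Fin (2 * 2))) x) (chartMem 0) x v) := by
  set Z := tangentBundleCore (𝓡 (2 * 2)) (ComplexProjectiveSpace 2)
  rw [Z.coordChange_comp]
  exact ⟨⟨Z.mem_baseSet_at x, h0⟩, h1⟩

/-! ### The clutching matrix of a stable framing along the line -/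

/-- **The clutching function of a stable framing of `Tℂℙ²` along `ℂℙ¹` extends over the disc.**
Given a stable framing `σ` of `f*Tℂℙ² ⊕ ℝ` along the line `f = lineIncl : ℂℙ¹ → ℂℙ²`, read it in
the affine chart `0` along `w ↦ [1 : w]` and in the affine chart `1` along `u ↦ [u : 1]`, as
invertible `5 × 5` frame matrices `F₀(w)`, `F₁(u)` depending continuously on `w, u ∈ ℂ`. On the
unit circle `[1 : w] = [w̄ : 1]` and `F₁(w̄) = J(w) F₀(w)` with `J(w) = cmat (-1/w²) (1/w)` the
realified Jacobian of the chart change; hence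
`G(w) = F₁(w̄) F₀(w)⁻¹ pmat(w)` is a continuous family of invertible matrices on all of `ℂ`
with `G(w) = cmat (-1/w²) (1/w) · cmat (-w) w = cmat (w̄) 1` on the unit circle — the stabilised rotation
loop `rotBlock 2`. (Milnor–Stasheff, *Characteristic Classes*, §14; Kirby, *The Topology of
4-Manifolds*, Ch. II §1 and Ch. IV: `w₂(ℂℙ²) ≠ 0` evaluates non-trivially on `ℂℙ¹`.) [cite: Kirby1989, Ch. IV (examples: for a complex surface ω₂ is the mod 2 reduction of c₁) and Ch. II §1 (normal bundle of CP¹ ⊂ CP² is the Hopf bundle)] -/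
theorem exists_clutching_extension
    {σ : Fin (Module.finrank ℝ (EuclideanSpace ℝ (Fin (2 * 2))) + 1) → ComplexProjectiveSpace 1 →
      EuclideanSpace ℝ (Fin (2 * 2)) × ℝ}
    (hσ1 : ∀ i, Continuous fun p ↦
      (TotalSpace.mk' (EuclideanSpace ℝ (Fin (2 * 2))) (lineInclCM p) (σ i p).1 :
        TangentBundle (𝓡 (2 * 2)) (ComplexProjectiveSpace 2)))
    (hσ2 : ∀ i, Continuous fun p ↦ (σ i p).2)
    (hli : ∀ p, LinearIndependent ℝ fun i ↦ σ i p) :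
    ∃ G : ℂ → Matrix (Fin 5) (Fin 5) ℝ, Continuous G ∧ (∀ w, (G w).det ≠ 0) ∧
      ∀ c s : ℝ, c ^ 2 + s ^ 2 = 1 → G (c + s * Complex.I) =
        Literature.AlgebraicTopology.FundamentalGroup.RotLoop.rotBlock 2 c s := by
  set Z := tangentBundleCore (𝓡 (2 * 2)) (ComplexProjectiveSpace 2) with hZ
  have hrank : Module.finrank ℝ (EuclideanSpace ℝ (Fin (2 * 2))) + 1 = 5 := by simp
  let e5 : Fin 5 ≃ Fin (Module.finrank ℝ (EuclideanSpace ℝ (Fin (2 * 2))) + 1) :=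
    finCongr hrank.symm
  -- the framing read in the affine chart `k` at the point `p` of the line
  obtain ⟨rd, hrd⟩ : ∃ rd : Fin 3 → ComplexProjectiveSpace 1 → Fin 5 →
      EuclideanSpace ℝ (Fin (2 * 2)) × ℝ,
      ∀ k p c, rd k p c = ((Z.localTriv (chartMem k)
        (TotalSpace.mk' (EuclideanSpace ℝ (Fin (2 * 2))) (lineIncl p) (σ (e5 c) p).1)).2,
          (σ (e5 c) p).2) :=
    ⟨_, fun _ _ _ ↦ rfl⟩
  have hrd1 : ∀ k p c, (rd k p c).1 =
      Z.coordChange (achart (EuclideanSpace ℝ (Fin (2 * 2))) (lineIncl p)) (chartMem k) (lineIncl p)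
        (σ (e5 c) p).1 :=
    fun k p c ↦ by rw [hrd]; rfl
  have hrd2 : ∀ k p c, (rd k p c).2 = (σ (e5 c) p).2 := fun k p c ↦ by rw [hrd]
  -- continuity of the readings on the chart domains
  have hcont1 : ∀ k c, ContinuousOn (fun p ↦ (rd k p c).1) {p | CoordNeZero k (lineIncl p)} := by
    intro k c
    have h := continuousOn_localTriv_chartMem (hσ1 (e5 c)) k
    refine h.congr fun p _ ↦ ?_
    rw [hrd]
    rfl
  have hcont2 : ∀ k c, Continuous fun p ↦ (rd k p c).2 := by
    intro k c
    simp only [hrd2]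
    exact hσ2 (e5 c)
  -- linear independence of the readings
  have hrdli : ∀ k p, CoordNeZero k (lineIncl p) → LinearIndependent ℝ (rd k p) := by
    intro k p hp
    let A := Z.coordChange (achart (EuclideanSpace ℝ (Fin (2 * 2))) (lineIncl p)) (chartMem k)
      (lineIncl p)
    let L : (EuclideanSpace ℝ (Fin (2 * 2)) × ℝ) →ₗ[ℝ] (EuclideanSpace ℝ (Fin (2 * 2)) × ℝ) :=
      (A : EuclideanSpace ℝ (Fin (2 * 2)) →ₗ[ℝ] EuclideanSpace ℝ (Fin (2 * 2))).prodMap LinearMap.id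
    have hL : LinearMap.ker L = ⊥ := by
      rw [LinearMap.ker_eq_bot]
      rintro ⟨a, b⟩ ⟨a', b'⟩ h
      simp only [L, LinearMap.prodMap_apply, LinearMap.id_apply, Prod.mk.injEq,
        ContinuousLinearMap.coe_coe] at h
      exact Prod.ext (coordChange_achart_chartMem_injective hp h.1) h.2
    have h1 : LinearIndependent ℝ (fun c ↦ σ (e5 c) p) := (hli p).comp e5 e5.injective
    have h2 := h1.map' L hL
    have hfun : rd k p = L ∘ fun c ↦ σ (e5 c) p := by
      funext c
      rw [hrd]
      rfl
    rw [hfun]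
    exact h2
  -- the two frame matrices
  obtain ⟨F0, hF0⟩ : ∃ F0 : ℂ → Matrix (Fin 5) (Fin 5) ℝ, ∀ w, F0 w = frameMat (rd 0 (linePt₀ w)) :=
    ⟨_, fun _ ↦ rfl⟩
  obtain ⟨F1, hF1⟩ : ∃ F1 : ℂ → Matrix (Fin 5) (Fin 5) ℝ, ∀ u, F1 u = frameMat (rd 1 (linePt₁ u)) :=
    ⟨_, fun _ ↦ rfl⟩
  have hF0c : Continuous F0 := by
    simp only [funext hF0]
    refine continuous_frameMat (fun c ↦ ?_) (fun c ↦ (hcont2 0 c).comp continuous_linePt₀)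
    exact (hcont1 0 c).comp_continuous continuous_linePt₀ coordNeZero_zero_lineIncl_linePt₀
  have hF1c : Continuous F1 := by
    simp only [funext hF1]
    refine continuous_frameMat (fun c ↦ ?_) (fun c ↦ (hcont2 1 c).comp continuous_linePt₁)
    exact (hcont1 1 c).comp_continuous continuous_linePt₁ coordNeZero_one_lineIncl_linePt₁
  have hF0d : ∀ w, (F0 w).det ≠ 0 := fun w ↦ by
    rw [hF0]; exact det_frameMat_ne_zero (hrdli 0 _ (coordNeZero_zero_lineIncl_linePt₀ w))
  have hF1d : ∀ u, (F1 u).det ≠ 0 := fun u ↦ by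
    rw [hF1]; exact det_frameMat_ne_zero (hrdli 1 _ (coordNeZero_one_lineIncl_linePt₁ u))
  -- the clutching identity on the unit circle
  have hclutch : ∀ w : ℂ, w * conj w = 1 →
      F1 (conj w) = cmat (-(w ^ 2)⁻¹) w⁻¹ * F0 w := by
    intro w hw1
    have hw0 : w ≠ 0 := by
      rintro rfl
      simp at hw1
    have hp : linePt₀ w = linePt₁ (conj w) := linePt₀_eq_linePt₁ hw1
    have hx0 : CoordNeZero 0 (lineIncl (linePt₀ w)) := coordNeZero_zero_lineIncl_linePt₀ w
    have hx1 : CoordNeZero 1 (lineIncl (linePt₀ w)) := coordNeZero_one_lineIncl_linePt₀ hw0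
    rw [hF1, hF0, ← hp]
    refine frameMat_eq_mul fun c ↦ ?_
    rw [cmat_mulVec_coord5]
    congr 1
    refine Prod.ext ?_ ?_
    · rw [hrd1, hrd1, ← coordChange_zero_one_apply hw0]
      exact coordChange_achart_one_eq hx0 hx1 _
    · rw [hrd2, hrd2]
  -- the extension over the plane
  refine ⟨fun w ↦ F1 (conj w) * (F0 w)⁻¹ * pmat w, ?_, fun w ↦ ?_, fun c s hcs ↦ ?_⟩
  · refine ((hF1c.comp Complex.continuous_conj).mul ?_).mul continuous_pmat
    refine continuous_iff_continuousAt.2 fun w ↦ ?_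
    refine (continuousAt_matrix_inv (F0 w) ?_).comp hF0c.continuousAt
    rw [Ring.inverse_eq_inv']
    exact continuousAt_inv₀ (hF0d w)
  · rw [det_mul, det_mul, det_nonsing_inv, Ring.inverse_eq_inv']
    exact mul_ne_zero (mul_ne_zero (hF1d _) (inv_ne_zero (hF0d w))) (det_pmat_ne_zero w)
  · set w : ℂ := c + s * Complex.I with hw
    have hre : w.re = c := by simp [hw]
    have him : w.im = s := by simp [hw]
    have hw1 : w * conj w = 1 := by
      rw [Complex.mul_conj, Complex.normSq_apply, hre, him]
      have : c * c + s * s = 1 := by linear_combination hcs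
      rw [this, Complex.ofReal_one]
    have hw0 : w ≠ 0 := by
      rintro h0
      rw [h0] at hw1
      simp at hw1
    have hsq : w.re ^ 2 + w.im ^ 2 = 1 := by rw [hre, him, hcs]
    show F1 (conj w) * (F0 w)⁻¹ * pmat w = _
    rw [hclutch w hw1, Matrix.mul_assoc (cmat _ _) (F0 w),
      Matrix.mul_nonsing_inv _ (isUnit_iff_ne_zero.2 (hF0d w)), Matrix.mul_one,
      pmat_of_sq_add_sq hsq, cmat_mul]
    have hconj : conj w = w⁻¹ := eq_inv_of_mul_eq_one_right hw1
    have h1 : -(w ^ 2)⁻¹ * -w = conj w := by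
      rw [hconj]
      field_simp
    have h2 : w⁻¹ * w = 1 := inv_mul_cancel₀ hw0
    rw [h1, h2, hw, cmat_conj_one,
      Literature.AlgebraicTopology.FundamentalGroup.RotLoop.rotBlock_two]

end ComplexProjectiveSpace

/-! ### The discharge: `ℂℙ²` is not spin -/

/-- **`ℂℙ²` is not spin** — discharge of the named fact
`Literature.Topology.FourManifolds.not_isSpin_complexProjectivePlane` of `SPC4Spin.lean`, for the
tree's notion `IsSpin` (Kirby's surface criterion: `f*Tℂℙ² ⊕ ℝ` trivial along every map `f` of a
closed surface). Take `f : ℂℙ¹ → ℂℙ²` the projective line. A stable framing of `f*Tℂℙ² ⊕ ℝ`, read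
in the two affine charts, shows that the clutching function of `Tℂℙ²|_{ℂℙ¹} ⊕ ℝ` along the
equator — the realification of `diag(-1/w², 1/w)`, of odd total degree `-3 = c₁(𝒪(2) ⊕ 𝒪(1))`
up to sign — extends continuously over the disc after multiplication by the explicitly
null-homotopic even loop `pmat` (`ComplexProjectiveSpace.exists_clutching_extension`); but the
resulting boundary loop is one full turn of a coordinate rotation stabilised to `GL₅(ℝ)`, which
does not extend over the disc (`RotLoop.disc_false`: `π₁(SO(3)) = ℤ/2` detects it, and the
dimension is lowered from `5` to `3` through `π₂(S⁴) = π₂(S³) = 0`). This is the classical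
computation `w₂(ℂℙ²) = c₁(ℂℙ²) mod 2 = 3x ≠ 0`, `⟨w₂, [ℂℙ¹]⟩ = 1` (Milnor–Stasheff, *Characteristic
Classes*, §14, Thm 14.10; Kirby, *The Topology of 4-Manifolds*, Ch. II Lemma 4.1 with §1
(`Q_{ℂℙ²} = ⟨1⟩` is odd) and Ch. IV ("if `M⁴` is a complex surface, then `ω₂` is the mod 2
reduction of `c₁`"); Gompf–Stipsicz, *4-Manifolds and Kirby Calculus*, Example 1.4.21 and
Cor. 5.7.6; Lawson–Michelsohn, *Spin Geometry*, Ch. II Example 2.4: `ℂℙⁿ` is spin iff `n` is odd).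
[cite: Kirby1989, Ch. II §4 Lemma 4.1 and §1 (form of CP² is (1)); Ch. IV (ω₂ = c₁ mod 2 for complex surfaces)] [cite: GompfStipsiczGSM1999, Example 1.4.21 and Cor. 5.7.6] -/
theorem not_isSpin_complexProjectivePlane_holds : not_isSpin_complexProjectivePlane := by
  intro h
  have h' : IsSpin (𝓡 (2 * 2)) (ComplexProjectiveSpace 2) := h
  obtain ⟨σ, hσ1, hσ2, hli⟩ := h'.2 (ComplexProjectiveSpace 1) ComplexProjectiveSpace.lineInclCM
  obtain ⟨G, hG, hdet, hcirc⟩ := ComplexProjectiveSpace.exists_clutching_extension hσ1 hσ2 hli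
  exact Literature.AlgebraicTopology.FundamentalGroup.RotLoop.disc_false 2 hG hdet hcirc

end Literature.Topology.FourManifolds
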